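import Summits.QuantumFields.BalabanUV.T4Continuum.Support.VariationalSmoothedMeans
import Summits.QuantumFields.BalabanUV.T4Continuum.Support.VariationalCovariantUpperBound
import Summits.QuantumFields.BalabanUV.T4Continuum.Support.VariationalCovariantScalarPair

/-!
# T⁴ programme, spine node NE2 (U1a), lane P2 — SUPPLIER s5a (ONE⁰-pos), file 3: THE ONE-STEP INTERPOLANT — block means restored
# EXACTLY by the in-block trial function, cross term by summation by parts; `hONE` of the P2 capstone AT `U = 1`, every `L`, every torus

NE2 formalisation swarm `b2b-balaban-t4-ne2-formalise-*`, leaf 04 GEN 2, supplier item «P2-SUPPLIER s5a = ONE⁰-pos» (journal INTENT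
CLAIMS.log l.8445), file 3 of 3; files 1/2 = `VariationalSmoothedPlanting` (the smoothed planting `A(P f)`, `Sf(A P f) ≤ Sc(f)`),
`VariationalSmoothedMeans` (`nsq (f − Q(A P f)) ≤ ¼·ρ_cube f`).

THE CONSTRUCTION ([folklore]; coarse torus `Tor N`, fine torus `Tor (fine L N)`, every `L ≥ 1`).  For a coarse `f` put `u := A(P f)`,
`r := f − Q u` (the second-order block-mean defect of file 2), `g := (β₁^d)⁻¹·ψ_r` (the in-block trial function of `ScalarBlockTrialFunction`
on the blocks of `Tor (fine L N)`: `Q ψ_r = β₁^d·r`, `nsq ψ_r ≤ L^d nsq r`, `Σ_ν nsq (∂_ν ψ_r) ≤ 4d·L^d·nsq r`) and the COMPETITOR `f′ := u + g`.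
 * §1 `Q f′ = f` EXACTLY (`QsOp_interp`).
 * §2 the cross term: `nsq (D(u + g)) ≤ nsq (Du) + nsq (Dg) + 2·√(nsq (D²u))·√(nsq g)` — `‖a + b‖² = ‖a‖² + ‖b‖² + 2Re(a b̄)`, summation by
   parts on the torus `Σ (Du)(D̄g) = −Σ (D²u)(· − e)·ḡ`, Cauchy–Schwarz (`nsq_fdiff_add_le`);
 * §3 assembling with file 1 (`nsq (D_μ u) ≤ L^d/L²·nsq (∇_μ f)`, `nsq (D_μ² u) ≤ L^d/L⁴·nsq (∇_μ² f)`) and file 2: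
     **`Σ_μ nsq (D_μ f′) ≤ L^d/L²·( Σ_μ nsq (∇_μ f) + d·(5/4·(β₁^d)⁻² + 1)·ρ_cube f )`**                       (`energy_interp_le`)
   — the coarse energy with constant EXACTLY 1 plus SECOND differences only; `(β₁^d)⁻² ≤ 36^d`;
 * §4 the ENDs: `∃ f′, Q f′ = f ∧ L²/L^d·Σ_μ nsq (D_μ f′) ≤ Σ_μ nsq (∇_μ f) + d(5/4·36^d + 1)·ρ_cube f` (`exists_interp`); the block-spin
   reading; and — in the letters of the P2 capstone `VariationalCovariantScalarPair` (p211992) at `U = 1` (`T′ ≡ 1`, `R′ ≡ 1`, `Rc ≡ 1`) —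
     **`hONE_flat : blockSpin (Q1 n L M 1) (Sf n L M 1) f ≤ Sc n M 1 f + (d(5/4·36^d + 1)/n²)·(n⁴/n^d·ρ_cube f) + 0·qW n M f`**,
   i.e. the capstone's binder `hONE` with `ρ f := n⁴/n^d·ρ_cube f` (physical `‖∇²f‖²`-type size), `ε₁ = C_d/n²`, `ε₂ = 0` — NO fine minimiser,
   NO Fourier, uniform in `L`, the torus and `n`.  The covariant dressing (phases `conj T′`, mismatch as in FED⁺) is item s5b, not here.

HONEST FRAMING (T4-DAG p. 1).  `U = 1`; [folklore] lattice analysis on the cell's carriers; statements and constants OURS and crude;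
nothing printed is a hypothesis; no `def … : Prop`; no `sorry`; axioms standard.  A SUPPLIER engine for ONE⁺ — NOT ONE⁺ with background,
NOT NE2⁺; NE2 NOT proved; spine 0/9; rung (B)+1 finite T⁴ — NOT infinite volume, NOT mass gap, NOT Clay.  HONEST DEPENDENCY (cell,
verbatim): continuum YM on T⁴ ⇐ BetaPertH ∧ nine spine estimates (0/9 proved); BetaPertH ⇐ (D1) ∧ (D4) ∧ CAP+tail; G-an2-4 gates asym,
D1 and NE2/3/4.
-/

noncomputable section

open scoped BigOperators Matrix ComplexConjugate
open Finset

namespace Summit.QuantumFields.BalabanUV.T4Continuum.VariationalOneStepInterpolant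

open Literature.MathematicalPhysics.QuantumFieldTheory.Balaban1983to89.B5Prop11Plancherel (Tor fine unitVec)
open Literature.MathematicalPhysics.QuantumFieldTheory.Balaban1983to89.B5Prop11Lower (nsq nsq_nonneg)
open Literature.MathematicalPhysics.QuantumFieldTheory.Balaban1983to89.B5Action121 (sdiff)
open Literature.MathematicalPhysics.QuantumFieldTheory.Balaban1983to89.B5Block118 (bpt QsOp QsOp_mulVec)
open Summit.QuantumFields.BalabanUV.T4Continuum.ScalarBlockPoincare (nsq_sum_le nsq_smul transS nsq_transS sdiff_mulVec_eq)
open Summit.QuantumFields.BalabanUV.T4Continuum.ScalarAveragedPropagator (dirichlet)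
open Summit.QuantumFields.BalabanUV.T4Continuum.ScalarBlockTrialFunction (beta1 beta1_ge trial QsOp_trial nsq_trial_le
  dirichlet_trial_le)
open Summit.QuantumFields.BalabanUV.T4Continuum.VariationalSmoothedPlanting (plant smooth nsq_fdiff_smooth_plant_le
  nsq_fdiff2_smooth_plant_le)
open Summit.QuantumFields.BalabanUV.T4Continuum.VariationalSmoothedMeans (rhoCube rhoCube_nonneg nsq_defect_le secondDiff cubeVec)
open Summit.QuantumFields.BalabanUV.T4Continuum.VariationalCovariantUpperBound (inv_beta_pow_mem)
open Summit.QuantumFields.BalabanUV.T4Continuum.VariationalTransfer (blockSpin blockSpin_le)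
open Summit.QuantumFields.BalabanUV.T4Continuum.VariationalCovariantFederbush (Qc dirU)
open Summit.QuantumFields.BalabanUV.T4Continuum.VariationalCovariantScalarPair (Sc Sf qW Q1)

variable {d : ℕ}

/-! ## §1 The competitor and its block means -/

section Interp

variable (L : ℕ) [NeZero L] (N : Fin d → ℕ) [hN : ∀ μ, NeZero (N μ)]

/-- the block-mean DEFECT of the smoothed planting: `r := f − Q(A P f)` (second order, file 2). [folklore] -/
def defect (f : Tor N → ℂ) : Tor N → ℂ := f - QsOp L N *ᵥ smooth L N (plant L N f)

/-- the CORRECTION `g := (β₁^d)⁻¹·ψ_r`, the in-block trial function of the defect. [folklore] -/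
def corr (f : Tor N → ℂ) : Tor (fine L N) → ℂ := ((((beta1 L) ^ d)⁻¹ : ℝ) : ℂ) • trial L N (defect L N f)

/-- **THE ONE-STEP INTERPOLANT** `f′ := A(P f) + g`. [folklore] -/
def interp (f : Tor N → ℂ) : Tor (fine L N) → ℂ := smooth L N (plant L N f) + corr L N f

/-- the correction restores the block means: `Q g = r`. [folklore] -/
theorem QsOp_corr (f : Tor N → ℂ) : QsOp L N *ᵥ corr L N f = defect L N f := by
  have hβ : (beta1 L) ^ d ≠ 0 := (pow_pos (beta1_ge L).2 d).ne'
  unfold corr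
  rw [Matrix.mulVec_smul, QsOp_trial, smul_smul]
  have e : ((((beta1 L) ^ d)⁻¹ : ℝ) : ℂ) * ((((beta1 L) ^ d : ℝ)) : ℂ) = 1 := by
    rw [← Complex.ofReal_mul, inv_mul_cancel₀ hβ, Complex.ofReal_one]
  rw [e, one_smul]

/-- **BLOCK MEANS EXACT**: `Q f′ = f`. [folklore] -/
theorem QsOp_interp (f : Tor N → ℂ) : QsOp L N *ᵥ interp L N f = f := by
  unfold interp
  rw [Matrix.mulVec_add, QsOp_corr]
  unfold defect
  abel

/-- the size of the correction: `nsq g ≤ (β₁^d)⁻²·L^d·nsq r`. [folklore] -/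
theorem nsq_corr_le (f : Tor N → ℂ) :
    nsq (corr L N f) ≤ (((beta1 L) ^ d)⁻¹) ^ 2 * ((L : ℝ) ^ d * nsq (defect L N f)) := by
  unfold corr
  rw [nsq_smul, Complex.norm_real, Real.norm_of_nonneg (inv_beta_pow_mem L (d := d)).1.le]
  exact mul_le_mul_of_nonneg_left (nsq_trial_le L N _) (sq_nonneg _)

/-- the energy of the correction: `Σ_μ nsq (D_μ g) ≤ (β₁^d)⁻²·4d·L^d/L²·nsq r` (leaf-09's `dirichlet_trial_le`, `∂_μ = L·D_μ`). [folklore] -/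
theorem sum_nsq_fdiff_corr_le (f : Tor N → ℂ) :
    ∑ μ, nsq (transS (fine L N) (unitVec (fine L N) μ) (corr L N f) - corr L N f)
      ≤ (((beta1 L) ^ d)⁻¹) ^ 2 * (4 * d * ((L : ℝ) ^ d * nsq (defect L N f)) / (L : ℝ) ^ 2) := by
  have hL : (0 : ℝ) < L := by exact_mod_cast Nat.pos_of_ne_zero (NeZero.ne L)
  have hc := (inv_beta_pow_mem L (d := d)).1
  -- `D_μ g = c • D_μ ψ_r` and `nsq (D_μ ψ) = nsq (∂_μ ψ)/L²`
  have e : ∀ μ, nsq (transS (fine L N) (unitVec (fine L N) μ) (corr L N f) - corr L N f)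
      = (((beta1 L) ^ d)⁻¹) ^ 2 * (nsq (sdiff (fine L N) (L : ℂ) μ *ᵥ trial L N (defect L N f)) / (L : ℝ) ^ 2) := by
    intro μ
    have h1 : transS (fine L N) (unitVec (fine L N) μ) (corr L N f) - corr L N f
        = ((((beta1 L) ^ d)⁻¹ : ℝ) : ℂ) •
            (transS (fine L N) (unitVec (fine L N) μ) (trial L N (defect L N f)) - trial L N (defect L N f)) := by
      unfold corr; rw [smul_sub]; rfl
    rw [h1, nsq_smul, Complex.norm_real, Real.norm_of_nonneg hc.le, sdiff_mulVec_eq, nsq_smul, Complex.norm_natCast]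
    field_simp
  rw [Finset.sum_congr rfl fun μ _ => e μ, ← Finset.mul_sum, ← Finset.sum_div]
  refine mul_le_mul_of_nonneg_left (div_le_div_of_nonneg_right ?_ (by positivity)) (sq_nonneg _)
  exact dirichlet_trial_le L N (defect L N f)

end Interp

/-! ## §2 The cross term by summation by parts -/

section Cross

variable (N : Fin d → ℕ) [hN : ∀ μ, NeZero (N μ)]

/-- `‖a + b‖² = ‖a‖² + ‖b‖² + 2Re Σ a·b̄`. [folklore] -/
theorem nsq_add_eq (a b : Tor N → ℂ) : nsq (a + b) = nsq a + nsq b + 2 * (∑ x, a x * conj (b x)).re := by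
  unfold nsq
  simp only [Pi.add_apply, Complex.re_sum, Finset.mul_sum, ← Finset.sum_add_distrib]
  refine Finset.sum_congr rfl fun x _ => ?_
  rw [← Complex.normSq_eq_norm_sq, ← Complex.normSq_eq_norm_sq, ← Complex.normSq_eq_norm_sq, Complex.normSq_add]

/-- Cauchy–Schwarz: `‖Σ p·q̄‖ ≤ √(nsq p)·√(nsq q)`. [folklore] -/
theorem norm_sum_mul_conj_le (p q : Tor N → ℂ) : ‖∑ x, p x * conj (q x)‖ ≤ Real.sqrt (nsq p) * Real.sqrt (nsq q) := by
  refine (norm_sum_le _ _).trans ?_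
  have h1 : ∑ x, ‖p x * conj (q x)‖ = ∑ x, ‖p x‖ * ‖q x‖ := Finset.sum_congr rfl fun x _ => by
    rw [norm_mul, Complex.norm_conj]
  rw [h1]
  unfold nsq
  rw [← Real.sqrt_mul (Finset.sum_nonneg fun _ _ => sq_nonneg _)]
  exact (le_abs_self _).trans (Real.abs_le_sqrt (Finset.sum_mul_sq_le_sq_mul_sq _ _ _))

/-- **SUMMATION BY PARTS ON THE TORUS**: `Σ (D a)(x)·conj((D g)(x)) = −Σ (D²a)(x − e)·conj(g x)`, `D h = h(· + e) − h`. [folklore] -/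
theorem sum_fdiff_mul_conj_fdiff (e : Tor N) (a g : Tor N → ℂ) :
    ∑ x, (transS N e a - a) x * conj ((transS N e g - g) x)
      = -∑ x, transS N (-e) (transS N e (transS N e a - a) - (transS N e a - a)) x * conj (g x) := by
  have shift : ∑ x, (transS N e a - a) x * conj (g (x + e)) = ∑ x, (transS N e a - a) (x + -e) * conj (g x) := by
    rw [← Equiv.sum_comp (Equiv.addRight e) (fun x => (transS N e a - a) (x + -e) * conj (g x))]
    simp only [Equiv.coe_addRight, add_neg_cancel_right]
  calc ∑ x, (transS N e a - a) x * conj ((transS N e g - g) x)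
      = ∑ x, ((transS N e a - a) x * conj (g (x + e)) - (transS N e a - a) x * conj (g x)) := by
        refine Finset.sum_congr rfl fun x _ => ?_
        simp only [Pi.sub_apply, transS, map_sub]
        ring
    _ = ∑ x, (transS N e a - a) (x + -e) * conj (g x) - ∑ x, (transS N e a - a) x * conj (g x) := by
        rw [Finset.sum_sub_distrib, shift]
    _ = -∑ x, transS N (-e) (transS N e (transS N e a - a) - (transS N e a - a)) x * conj (g x) := by
        rw [← Finset.sum_sub_distrib, ← Finset.sum_neg_distrib]
        refine Finset.sum_congr rfl fun x _ => ?_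
        simp only [Pi.sub_apply, transS, neg_add_cancel_right]
        ring

/-- **THE CROSS-TERM BOUND**: `nsq (D(u + g)) ≤ nsq (D u) + nsq (D g) + 2·√(nsq (D²u))·√(nsq g)`. [folklore] -/
theorem nsq_fdiff_add_le (e : Tor N) (u g : Tor N → ℂ) :
    nsq (transS N e (u + g) - (u + g))
      ≤ nsq (transS N e u - u) + nsq (transS N e g - g)
        + 2 * (Real.sqrt (nsq (transS N e (transS N e u - u) - (transS N e u - u))) * Real.sqrt (nsq g)) := by
  have hsplit : transS N e (u + g) - (u + g) = (transS N e u - u) + (transS N e g - g) := by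
    funext x; simp only [Pi.sub_apply, Pi.add_apply, transS]; ring
  rw [hsplit, nsq_add_eq, sum_fdiff_mul_conj_fdiff]
  have h := norm_sum_mul_conj_le N (transS N (-e) (transS N e (transS N e u - u) - (transS N e u - u))) g
  rw [nsq_transS] at h
  have hre := Complex.re_le_norm (-∑ x, transS N (-e) (transS N e (transS N e u - u) - (transS N e u - u)) x * conj (g x))
  rw [norm_neg] at hre
  linarith

omit hN in
/-- `2√X√Y ≤ s·X + Y/s` for `s > 0`. [folklore] -/
theorem two_sqrt_mul_sqrt_le {X Y s : ℝ} (hX : 0 ≤ X) (hY : 0 ≤ Y) (hs : 0 < s) :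
    2 * (Real.sqrt X * Real.sqrt Y) ≤ s * X + Y / s := by
  have h1 : Real.sqrt X * Real.sqrt Y = Real.sqrt (s * X) * Real.sqrt (Y / s) := by
    rw [← Real.sqrt_mul hX, ← Real.sqrt_mul (by positivity)]
    congr 1; field_simp
  rw [h1]
  nlinarith [sq_nonneg (Real.sqrt (s * X) - Real.sqrt (Y / s)), Real.sq_sqrt (by positivity : 0 ≤ s * X),
    Real.sq_sqrt (by positivity : 0 ≤ Y / s)]

end Cross

/-! ## §3 The energy of the interpolant -/

section Energy

variable (L : ℕ) [NeZero L] (N : Fin d → ℕ) [hN : ∀ μ, NeZero (N μ)]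

/-- a directional second difference is one term of `ρ_cube` (the cube vector `𝟙 + e_μ − 𝟙 = e_μ`). [folklore] -/
theorem nsq_secondDiff_dir_le (f : Tor N → ℂ) (μ : Fin d) :
    nsq (transS N (unitVec N μ) (transS N (unitVec N μ) f - f) - (transS N (unitVec N μ) f - f)) ≤ rhoCube N f := by
  -- the forward second difference is a translate of the centred one along `e_μ = cubeVec (𝟙 with digit 2 at μ)`
  set eμ : Fin d → Fin 3 := Function.update (fun _ => (1 : Fin 3)) μ 2 with heμ
  have hv : cubeVec N eμ = unitVec N μ := by
    funext ν
    simp only [cubeVec, heμ, unitVec, Function.update_apply]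
    by_cases h : ν = μ
    · subst h; simp; norm_num
    · simp [h]
  have htr : transS N (unitVec N μ) (transS N (unitVec N μ) f - f) - (transS N (unitVec N μ) f - f)
      = transS N (unitVec N μ) (secondDiff N (cubeVec N eμ) f) := by
    funext x
    simp only [Pi.sub_apply, transS, secondDiff, hv, add_sub_cancel_right]
    ring
  rw [htr, nsq_transS]
  exact Finset.single_le_sum (f := fun e : Fin d → Fin 3 => nsq (secondDiff N (cubeVec N e) f))
    (fun _ _ => nsq_nonneg _) (Finset.mem_univ eμ)

/-- **THE ENERGY OF THE ONE-STEP INTERPOLANT**: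
`Σ_μ nsq (D_μ f′) ≤ L^d/L²·( Σ_μ nsq (∇_μ f) + d·(5/4·(β₁^d)⁻² + 1)·ρ_cube f )`. [folklore] -/
theorem energy_interp_le (f : Tor N → ℂ) :
    ∑ μ, nsq (transS (fine L N) (unitVec (fine L N) μ) (interp L N f) - interp L N f)
      ≤ (L : ℝ) ^ d / (L : ℝ) ^ 2 *
        (∑ μ, nsq (transS N (unitVec N μ) f - f) + d * (5 / 4 * (((beta1 L) ^ d)⁻¹) ^ 2 + 1) * rhoCube N f) := by
  have hL : (0 : ℝ) < L := by exact_mod_cast Nat.pos_of_ne_zero (NeZero.ne L)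
  have hLd : (0 : ℝ) < (L : ℝ) ^ d := by positivity
  set c : ℝ := ((beta1 L) ^ d)⁻¹ with hc
  have hc0 : 0 < c := (inv_beta_pow_mem L (d := d)).1
  set u := smooth L N (plant L N f) with hu
  set g := corr L N f with hg
  set ρ := rhoCube N f with hρ
  have hρ0 : 0 ≤ ρ := rhoCube_nonneg N f
  have hr : nsq (defect L N f) ≤ 1 / 4 * ρ := nsq_defect_le L N f
  -- per direction: main + correction + cross
  have hμ : ∀ μ : Fin d, nsq (transS (fine L N) (unitVec (fine L N) μ) (interp L N f) - interp L N f)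
      ≤ (L : ℝ) ^ d / (L : ℝ) ^ 2 * nsq (transS N (unitVec N μ) f - f)
        + nsq (transS (fine L N) (unitVec (fine L N) μ) g - g)
        + ((L : ℝ) ^ d / (L : ℝ) ^ 2 * ρ + c ^ 2 * ((L : ℝ) ^ d * (1 / 4 * ρ)) / (L : ℝ) ^ 2) := by
    intro μ
    have h0 := nsq_fdiff_add_le (fine L N) (unitVec (fine L N) μ) u g
    have h1 := nsq_fdiff_smooth_plant_le L N f μ
    have h2 := nsq_fdiff2_smooth_plant_le L N f μ
    have h3 : nsq (transS N (unitVec N μ) (transS N (unitVec N μ) f - f) - (transS N (unitVec N μ) f - f)) ≤ ρ :=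
      nsq_secondDiff_dir_le N f μ
    have hX : nsq (transS (fine L N) (unitVec (fine L N) μ) (transS (fine L N) (unitVec (fine L N) μ) u - u)
        - (transS (fine L N) (unitVec (fine L N) μ) u - u)) ≤ (L : ℝ) ^ d / (L : ℝ) ^ 4 * ρ :=
      h2.trans (mul_le_mul_of_nonneg_left h3 (by positivity))
    have hY : nsq g ≤ c ^ 2 * ((L : ℝ) ^ d * (1 / 4 * ρ)) :=
      (nsq_corr_le L N f).trans (mul_le_mul_of_nonneg_left (mul_le_mul_of_nonneg_left hr hLd.le) (sq_nonneg _))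
    have hcross : 2 * (Real.sqrt (nsq (transS (fine L N) (unitVec (fine L N) μ) (transS (fine L N) (unitVec (fine L N) μ) u - u)
          - (transS (fine L N) (unitVec (fine L N) μ) u - u))) * Real.sqrt (nsq g))
        ≤ (L : ℝ) ^ 2 * ((L : ℝ) ^ d / (L : ℝ) ^ 4 * ρ) + (c ^ 2 * ((L : ℝ) ^ d * (1 / 4 * ρ))) / (L : ℝ) ^ 2 := by
      refine (mul_le_mul_of_nonneg_left (mul_le_mul (Real.sqrt_le_sqrt hX) (Real.sqrt_le_sqrt hY) (Real.sqrt_nonneg _)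
        (Real.sqrt_nonneg _)) (by norm_num)).trans ?_
      exact two_sqrt_mul_sqrt_le (by positivity) (by positivity) (by positivity)
    have e4 : (L : ℝ) ^ 2 * ((L : ℝ) ^ d / (L : ℝ) ^ 4 * ρ) = (L : ℝ) ^ d / (L : ℝ) ^ 2 * ρ := by
      field_simp
    rw [e4] at hcross
    have := h0.trans (add_le_add (add_le_add h1 le_rfl) hcross)
    simpa [hu, hg, interp] using this
  -- sum over directions
  have hsum := Finset.sum_le_sum fun μ (_ : μ ∈ (Finset.univ : Finset (Fin d))) => hμ μ
  rw [Finset.sum_add_distrib, Finset.sum_add_distrib, ← Finset.mul_sum, Finset.sum_const, Finset.card_univ, Fintype.card_fin,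
    nsmul_eq_mul] at hsum
  have hcorr : ∑ μ, nsq (transS (fine L N) (unitVec (fine L N) μ) g - g) ≤ c ^ 2 * (4 * d * ((L : ℝ) ^ d * (1 / 4 * ρ)) / (L : ℝ) ^ 2) := by
    refine (sum_nsq_fdiff_corr_le L N f).trans ?_
    refine mul_le_mul_of_nonneg_left (div_le_div_of_nonneg_right ?_ (by positivity)) (sq_nonneg _)
    exact mul_le_mul_of_nonneg_left (mul_le_mul_of_nonneg_left hr hLd.le) (by positivity)
  refine hsum.trans ?_
  have hS : 0 ≤ ∑ μ, nsq (transS N (unitVec N μ) f - f) := Finset.sum_nonneg fun _ _ => nsq_nonneg _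
  have hd : (0 : ℝ) ≤ d := Nat.cast_nonneg d
  calc (L : ℝ) ^ d / (L : ℝ) ^ 2 * ∑ μ, nsq (transS N (unitVec N μ) f - f)
        + ∑ μ, nsq (transS (fine L N) (unitVec (fine L N) μ) g - g)
        + d * ((L : ℝ) ^ d / (L : ℝ) ^ 2 * ρ + c ^ 2 * ((L : ℝ) ^ d * (1 / 4 * ρ)) / (L : ℝ) ^ 2)
      ≤ (L : ℝ) ^ d / (L : ℝ) ^ 2 * ∑ μ, nsq (transS N (unitVec N μ) f - f)
        + c ^ 2 * (4 * d * ((L : ℝ) ^ d * (1 / 4 * ρ)) / (L : ℝ) ^ 2)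
        + d * ((L : ℝ) ^ d / (L : ℝ) ^ 2 * ρ + c ^ 2 * ((L : ℝ) ^ d * (1 / 4 * ρ)) / (L : ℝ) ^ 2) := by linarith
    _ = (L : ℝ) ^ d / (L : ℝ) ^ 2 * (∑ μ, nsq (transS N (unitVec N μ) f - f) + d * (5 / 4 * c ^ 2 + 1) * ρ) := by
        field_simp
        ring

/-- the explicit constant: `(β₁^d)⁻² ≤ 36^d`. [folklore] -/
theorem inv_beta_sq_le : (((beta1 L) ^ d)⁻¹) ^ 2 ≤ (36 : ℝ) ^ d := by
  obtain ⟨hc0, hc6⟩ := inv_beta_pow_mem L (d := d)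
  calc (((beta1 L) ^ d)⁻¹) ^ 2 ≤ ((6 : ℝ) ^ d) ^ 2 := pow_le_pow_left₀ hc0.le hc6 2
    _ = (36 : ℝ) ^ d := by rw [← pow_mul, mul_comm, pow_mul]; norm_num

/-! ## §4 The ENDs -/

/-- **ONE-STEP CONSISTENCY AT `U = 1`, POSITION SPACE (lattice units)**: every coarse `f` has a fine competitor with the SAME block means and
`L²/L^d·Σ_μ nsq (D_μ f′) ≤ Σ_μ nsq (∇_μ f) + d·(5/4·36^d + 1)·ρ_cube f` — coarse energy with constant EXACTLY 1 plus second differences;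
every `L ≥ 1`, every torus, no Fourier, no fine minimiser. [folklore] -/
theorem exists_interp (f : Tor N → ℂ) :
    ∃ f' : Tor (fine L N) → ℂ, QsOp L N *ᵥ f' = f ∧
      (L : ℝ) ^ 2 / (L : ℝ) ^ d * ∑ μ, nsq (transS (fine L N) (unitVec (fine L N) μ) f' - f')
        ≤ ∑ μ, nsq (transS N (unitVec N μ) f - f) + d * (5 / 4 * (36 : ℝ) ^ d + 1) * rhoCube N f := by
  have hL : (0 : ℝ) < L := by exact_mod_cast Nat.pos_of_ne_zero (NeZero.ne L)
  have hLd : (0 : ℝ) < (L : ℝ) ^ d := by positivity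
  refine ⟨interp L N f, QsOp_interp L N f, ?_⟩
  have h := energy_interp_le L N f
  have hρ := rhoCube_nonneg N f
  have hd : (0 : ℝ) ≤ d := Nat.cast_nonneg d
  have hβ := inv_beta_sq_le L (d := d)
  rw [div_mul_eq_mul_div, div_le_iff₀ hLd]
  calc (L : ℝ) ^ 2 * ∑ μ, nsq (transS (fine L N) (unitVec (fine L N) μ) (interp L N f) - interp L N f)
      ≤ (L : ℝ) ^ 2 * ((L : ℝ) ^ d / (L : ℝ) ^ 2 *
          (∑ μ, nsq (transS N (unitVec N μ) f - f) + d * (5 / 4 * (((beta1 L) ^ d)⁻¹) ^ 2 + 1) * rhoCube N f)) :=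
        mul_le_mul_of_nonneg_left h (by positivity)
    _ = (∑ μ, nsq (transS N (unitVec N μ) f - f) + d * (5 / 4 * (((beta1 L) ^ d)⁻¹) ^ 2 + 1) * rhoCube N f) * (L : ℝ) ^ d := by
        field_simp
    _ ≤ (∑ μ, nsq (transS N (unitVec N μ) f - f) + d * (5 / 4 * (36 : ℝ) ^ d + 1) * rhoCube N f) * (L : ℝ) ^ d := by
        gcongr

/-- **THE BLOCK-SPIN READING** (`Δ^{(1)}(f) ≤ Sc(f) + C·ρ(f)` in lattice units with the one-step prefactor): the one-step effective action
`inf {L²/L^d·Σ_μ nsq (D_μ f′) : Q f′ = f}` is at most the coarse energy plus second differences. [folklore] -/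
theorem blockSpin_oneStep_le (f : Tor N → ℂ) :
    blockSpin (fun f' : Tor (fine L N) → ℂ => QsOp L N *ᵥ f')
        (fun f' => (L : ℝ) ^ 2 / (L : ℝ) ^ d * ∑ μ, nsq (transS (fine L N) (unitVec (fine L N) μ) f' - f')) f
      ≤ ∑ μ, nsq (transS N (unitVec N μ) f - f) + d * (5 / 4 * (36 : ℝ) ^ d + 1) * rhoCube N f := by
  obtain ⟨f', hf', hb⟩ := exists_interp L N f
  have hS : ∀ g : Tor (fine L N) → ℂ,
      0 ≤ (L : ℝ) ^ 2 / (L : ℝ) ^ d * ∑ μ, nsq (transS (fine L N) (unitVec (fine L N) μ) g - g) := fun g =>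
    mul_nonneg (by positivity) (Finset.sum_nonneg fun _ _ => nsq_nonneg _)
  exact (blockSpin_le hS hf').trans hb

end Energy

/-! ## §5 `hONE` of the P2 capstone at `U = 1` -/

section Capstone

variable (n L : ℕ) [NeZero n] [NeZero L] (M : Fin d → ℕ) [hM : ∀ μ, NeZero (M μ)]

/-- the capstone's one-step average at `T′ ≡ 1` is the plain block average `Q`. [folklore] -/
theorem Q1_one (f' : Tor (fine L (fine n M)) → ℂ) :
    Q1 n L M (fun _ => (1 : ℂ)) f' = QsOp L (fine n M) *ᵥ f' := by
  funext y
  simp only [Q1, Qc, one_mul, QsOp_mulVec, one_div]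

/-- the capstone's Dirichlet sums at unit transporters are plain difference energies. [folklore] -/
theorem dirU_one {N' : Fin d → ℕ} [∀ μ, NeZero (N' μ)] (f : Tor N' → ℂ) (μ : Fin d) :
    dirU N' (fun _ _ => (1 : ℂ)) f μ = nsq (transS N' (unitVec N' μ) f - f) := by
  simp only [dirU, VariationalCovariantFederbush.cD, one_mul, nsq, Pi.sub_apply, transS]

/-- **`hONE` OF `VariationalCovariantScalarPair.scalar_pair_bracket` AT `U = 1`** (`T′ ≡ 1`, `R′ ≡ 1`, `Rc ≡ 1`): for every level-`n` field `f`,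
`blockSpin (Q1 n L M 1) (Sf n L M 1) f ≤ Sc n M 1 f + (d(5/4·36^d + 1)/n²)·(n⁴/n^d·ρ_cube f) + 0·qW n M f` — the binder's shape with
`ρ f := n⁴/n^d·ρ_cube f`, `ε₁ = d(5/4·36^d + 1)/n²`, `ε₂ = 0`; uniform in `L`, `n`, the torus. [folklore] -/
theorem hONE_flat (f : Tor (fine n M) → ℂ) :
    blockSpin (Q1 n L M (fun _ => (1 : ℂ))) (Sf n L M (fun _ _ => (1 : ℂ))) f
      ≤ Sc n M (fun _ _ => (1 : ℂ)) f
        + (d * (5 / 4 * (36 : ℝ) ^ d + 1) / (n : ℝ) ^ 2) * ((n : ℝ) ^ 4 / (n : ℝ) ^ d * rhoCube (fine n M) f)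
        + 0 * qW n M f := by
  have hn : (0 : ℝ) < n := by exact_mod_cast Nat.pos_of_ne_zero (NeZero.ne n)
  have hL : (0 : ℝ) < L := by exact_mod_cast Nat.pos_of_ne_zero (NeZero.ne L)
  have hnd : (0 : ℝ) < (n : ℝ) ^ d := by positivity
  obtain ⟨f', hf', hb⟩ := exists_interp L (fine n M) f
  have hS : ∀ g : Tor (fine L (fine n M)) → ℂ, 0 ≤ Sf n L M (fun _ _ => (1 : ℂ)) g :=
    VariationalCovariantScalarPair.Sf_nonneg n L M _
  have hQ : Q1 n L M (fun _ => (1 : ℂ)) f' = f := by rw [Q1_one, hf']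
  refine (blockSpin_le hS hQ).trans ?_
  rw [zero_mul, add_zero]
  -- `Sf 1 f′ = n²/n^d · (L²/L^d Σ nsq (D f′))` and `Sc 1 f = n²/n^d · Σ nsq (∇ f)`
  simp only [Sf, Sc, dirU_one]
  have e1 : ((n : ℝ) * L) ^ 2 / ((n : ℝ) * L) ^ d * ∑ μ, nsq (transS (fine L (fine n M)) (unitVec (fine L (fine n M)) μ) f' - f')
      = (n : ℝ) ^ 2 / (n : ℝ) ^ d *
        ((L : ℝ) ^ 2 / (L : ℝ) ^ d * ∑ μ, nsq (transS (fine L (fine n M)) (unitVec (fine L (fine n M)) μ) f' - f')) := by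
    rw [mul_pow, mul_pow]; field_simp
  rw [e1]
  calc (n : ℝ) ^ 2 / (n : ℝ) ^ d *
        ((L : ℝ) ^ 2 / (L : ℝ) ^ d * ∑ μ, nsq (transS (fine L (fine n M)) (unitVec (fine L (fine n M)) μ) f' - f'))
      ≤ (n : ℝ) ^ 2 / (n : ℝ) ^ d *
        (∑ μ, nsq (transS (fine n M) (unitVec (fine n M) μ) f - f) + d * (5 / 4 * (36 : ℝ) ^ d + 1) * rhoCube (fine n M) f) :=
        mul_le_mul_of_nonneg_left hb (by positivity)
    _ = _ := by field_simp

end Capstone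

end Summit.QuantumFields.BalabanUV.T4Continuum.VariationalOneStepInterpolant

end
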